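import Summits.MatrixMultiplication.OmegaCensus.Dicyclic16ShapeFCoset
import HarnessLib

/-!
# Dicyclic type, `|A| = 16`: the shape `(1,2 | 1,2 | 2,2)` does not occur (abstract form of `no_36_shape_f`)

ω-census, family (b3).  Framing: lottery ticket; floor = certified bounds/negative ranges.

`no_36_shape_f`: with `d_S, d_T, d_U, d_V` the differences of the two-element parts `S₁, T₁, U₀, U₁`, the exact vertex
`111` makes `a₀+T₁+U₁` and `S₁+t+U₁` periodic (two-set criterion on `(d_T,d_V)`, `(d_S,d_V)`), and the exact vertex
`110` (vertex `000` of `(S·τ0, T·τ0, U)`) does the same for `(−d_T, d_U)`, `(−d_S, d_U)`.  If `d_V = d_U = c₀` the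
configuration descends to `ℤ₂ × ℤ₄` (`no_36_shape_f_coset`); in every other branch two parts are periodic inside one
injective box, or `d_S = d_T` (collision in `S₁+T₁+U₀`), or `d_V = d_S + d_T` (collision in `S₁+T₁+U₁`).
-/

namespace Summit.MatrixMultiplication.OmegaCensus

open Literature.Combinatorics.Additive Finset

section ShapeF

variable {A : Type*} [AddCommGroup A] [DecidableEq A] [Fintype A] {G : Type} [Group G] [DecidableEq G]
  {ρ τ : A → G} {c₀ : A} {S T U : Finset G} {Q : Type*} [AddCommGroup Q] [DecidableEq Q]

/-- **Shape `(1,2 | 1,2 | 2,2)` is impossible in dicyclic type with `|A| = 16`**, given a projection `π` with fibres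
`{x, x + c₀}` onto a group without the exact 3-piece tiling (abstract form of `no_36_shape_f`). [folklore] -/
theorem no_36_shape_f_abs
    (hρρ : ∀ a b, ρ a * ρ b = ρ (a + b)) (hρτ : ∀ a b, ρ a * τ b = τ (b - a))
    (hτρ : ∀ a b, τ a * ρ b = τ (a + b))
    (hττ : ∀ a b, τ a * τ b = ρ (c₀ + b - a))
    (hρ : Function.Injective ρ) (hτ : Function.Injective τ) (hne : ∀ a b, ρ a ≠ τ b)
    (hc₀ : c₀ ≠ 0) (hA : Fintype.card A = 16)
    (h : TripleProductProperty S T U)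
    (hs₀ : (univ.filter fun a : A => ρ a ∈ S).card = 1)
    (hs₁ : (univ.filter fun a : A => τ a ∈ S).card = 2)
    (ht₀ : (univ.filter fun a : A => ρ a ∈ T).card = 1)
    (ht₁ : (univ.filter fun a : A => τ a ∈ T).card = 2)
    (hu₀ : (univ.filter fun a : A => ρ a ∈ U).card = 2)
    (hu₁ : (univ.filter fun a : A => τ a ∈ U).card = 2)
    (π : A →+ Q) (hπ : ∀ X Y : A, π X = π Y ↔ (Y = X ∨ Y = X + c₀))
    (hQ : ∀ d e a b : Q, d ≠ 0 → e ≠ 0 → d ≠ e → d + e ≠ 0 →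
      a ∉ ({0, d, e, d + e} : Finset Q) → a + e ∉ ({0, d, e, d + e} : Finset Q) →
      b ∉ ({0, d, e, d + e} : Finset Q) → b + d ∉ ({0, d, e, d + e} : Finset Q) →
      a ≠ b → a ≠ b + d → a + e ≠ b → a + e ≠ b + d → False) : False := by
  have h2c : c₀ + c₀ = 0 := two_c0_eq_zero hρτ hτρ hττ hτ
  set S₀ : Finset (A) := univ.filter fun a => ρ a ∈ S with hS₀
  set S₁ : Finset (A) := univ.filter fun a => τ a ∈ S with hS₁
  set T₀ : Finset (A) := univ.filter fun a => ρ a ∈ T with hT₀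
  set T₁ : Finset (A) := univ.filter fun a => τ a ∈ T with hT₁
  set U₀ : Finset (A) := univ.filter fun a => ρ a ∈ U with hU₀
  set U₁ : Finset (A) := univ.filter fun a => τ a ∈ U with hU₁
  have mS₀ : ∀ a ∈ S₀, cond false (τ a) (ρ a) ∈ S := fun a ha => by simpa [hS₀] using ha
  have mS₁ : ∀ a ∈ S₁, cond true (τ a) (ρ a) ∈ S := fun a ha => by simpa [hS₁] using ha
  have mT₀ : ∀ a ∈ T₀, cond false (τ a) (ρ a) ∈ T := fun a ha => by simpa [hT₀] using ha
  have mT₁ : ∀ a ∈ T₁, cond true (τ a) (ρ a) ∈ T := fun a ha => by simpa [hT₁] using ha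
  have mU₀ : ∀ a ∈ U₀, cond false (τ a) (ρ a) ∈ U := fun a ha => by simpa [hU₀] using ha
  have mU₁ : ∀ a ∈ U₁, cond true (τ a) (ρ a) ∈ U := fun a ha => by simpa [hU₁] using ha
  have cs := card_sumset' hρρ hττ hρ hτ h
  have inj := sum_injOn' hρρ hττ hρ hτ h
  obtain ⟨a₀, hS₀a⟩ := card_eq_one.1 hs₀
  obtain ⟨t, hT₀t⟩ := card_eq_one.1 ht₀
  obtain ⟨s₁, s₂, hs12, hS₁eq⟩ := card_eq_two.1 hs₁
  obtain ⟨t₁, t₂, ht12, hT₁eq⟩ := card_eq_two.1 ht₁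
  obtain ⟨u₁, u₂, hu12, hU₀eq⟩ := card_eq_two.1 hu₀
  obtain ⟨v₁, v₂, hv12, hU₁eq⟩ := card_eq_two.1 hu₁
  have hs₁m : s₁ ∈ S₁ := by rw [hS₁eq]; simp
  have hs₂m : s₂ ∈ S₁ := by rw [hS₁eq]; simp
  have ht₁m : t₁ ∈ T₁ := by rw [hT₁eq]; simp
  have ht₂m : t₂ ∈ T₁ := by rw [hT₁eq]; simp
  have hu₁m : u₁ ∈ U₀ := by rw [hU₀eq]; simp
  have hu₂m : u₂ ∈ U₀ := by rw [hU₀eq]; simp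
  have hv₁m : v₁ ∈ U₁ := by rw [hU₁eq]; simp
  have hv₂m : v₂ ∈ U₁ := by rw [hU₁eq]; simp
  have memU₀ : ∀ x ∈ U₀, x = u₁ ∨ x = u₂ := fun x hx => by simpa [hU₀eq] using hx
  have memU₁ : ∀ x ∈ U₁, x = v₁ ∨ x = v₂ := fun x hx => by simpa [hU₁eq] using hx
  have i110 := triple_of_sum_injOn (inj true true false mS₁ mT₁ mU₀)
  have i111 := triple_of_sum_injOn (inj true true true mS₁ mT₁ mU₁)
  -- periodicity of a two-element set from its difference
  have per2 : ∀ {x₁ x₂ : A}, x₂ - x₁ = c₀ →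
      ({x₁, x₂} : Finset (A)).image (· + c₀) = {x₁, x₂} := by
    intro x₁ x₂ hd
    rw [image_insert, image_singleton]
    have e1 : x₁ + c₀ = x₂ := by rw [← hd]; abel
    have e2 : x₂ + c₀ = x₁ := by linear_combination (norm := abel1) hd + h2c
    rw [e1, e2, pair_comm]
  -- collisions
  have noST : t₂ - t₁ ≠ s₂ - s₁ := fun hh =>
    hs12 (i110 s₁ hs₁m s₂ hs₂m t₂ ht₂m t₁ ht₁m u₁ hu₁m u₁ hu₁m (by linear_combination (norm := abel1) hh)).1
  have no111 : v₂ - v₁ ≠ (s₂ - s₁) + (t₂ - t₁) := fun hh =>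
    hs12 (i111 s₁ hs₁m s₂ hs₂m t₁ ht₁m t₂ ht₂m v₂ hv₂m v₁ hv₁m (by linear_combination (norm := abel1) hh)).1
  -- (1) the exact vertex `111`
  set B011 := (S₀ ×ˢ T₁ ×ˢ U₁).image fun p : (A) × (A) × (A) =>
    p.1 + p.2.1 + p.2.2 with hB011
  set B101 := (S₁ ×ˢ T₀ ×ˢ U₁).image fun p : (A) × (A) × (A) =>
    p.1 + p.2.1 + p.2.2 with hB101
  set B110 := (S₁ ×ˢ T₁ ×ˢ U₀).image fun p : (A) × (A) × (A) =>
    p.1 + p.2.1 + p.2.2 with hB110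
  have d₁ : Disjoint B101 B011 := (disjoint_sumset₁' hρρ hρτ hτρ hττ hne h) true mS₁ mT₀ mU₁ mS₀ mT₁
  have d₂ : Disjoint B110 B101 := (disjoint_sumset₂' hρρ hρτ hτρ hττ hne h) true mS₁ mT₁ mU₀ mS₁ mT₀ mU₁
  have d₃ : Disjoint B011 B110 := (disjoint_sumset₃' hρρ hρτ hτρ hττ hne h) true mS₀ mT₁ mU₁ mS₁ mU₀
  have sh₁ : Disjoint B101 (B011.image (· + c₀)) :=
    (disjoint_sumset₁_shift' hρρ hρτ hττ hne h) true mS₁ mT₀ mU₁ mS₀ mT₁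
  have sh₂ : Disjoint (B101.image (· + c₀)) B110 :=
    (disjoint_sumset₂_shift' hρρ hρτ hττ hne h) true mS₁ mT₀ mU₁ mS₁ mT₁ mU₀
  have sh₃ : Disjoint B110 (B011.image (· + c₀)) :=
    (disjoint_sumset₃_shift' hρρ hρτ hτρ hττ hne h) true mS₁ mT₁ mU₀ mS₀ mU₁
  have c011 : B011.card = 4 := by rw [hB011, cs false true true mS₀ mT₁ mU₁, hs₀, ht₁, hu₁]
  have c101 : B101.card = 4 := by rw [hB101, cs true false true mS₁ mT₀ mU₁, hs₁, ht₀, hu₁]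
  have c110 : B110.card = 8 := by rw [hB110, cs true true false mS₁ mT₁ mU₀, hs₁, ht₁, hu₀]
  have hper011 : B011.image (· + c₀) = B011 :=
    periodic_of_exact_vertex d₁.symm d₃ d₂.symm (by rw [c011, c101, c110, hA]) sh₁.symm sh₃.symm
  have hper101 : B101.image (· + c₀) = B101 :=
    periodic_of_exact_vertex d₁ d₂.symm d₃ (by rw [c011, c101, c110, hA]) (disjoint_image_add_comm h2c sh₁) sh₂
  -- the two criteria of vertex `111`
  have critTV : t₂ - t₁ = c₀ ∨ v₂ - v₁ = c₀ ∨ ((t₂ - t₁) + (t₂ - t₁) = 0 ∧ (t₂ - t₁) + (v₂ - v₁) = c₀) := by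
    rw [hB011, hS₀a, hT₁eq, hU₁eq] at hper011
    exact two_set_criterion_fst hc₀ h2c ht12 hv12 hper011
  have critSV : s₂ - s₁ = c₀ ∨ v₂ - v₁ = c₀ ∨ ((s₂ - s₁) + (s₂ - s₁) = 0 ∧ (s₂ - s₁) + (v₂ - v₁) = c₀) := by
    rw [hB101, hS₁eq, hT₀t, hU₁eq] at hper101
    exact two_set_criterion_mid hc₀ h2c hs12 hv12 hper101
  by_cases hdV : v₂ - v₁ = c₀
  · -- Case A: `U₁` is a `⟨c₀⟩`-coset
    have hU₁per := per2 hdV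
    have hU₁c : ∀ z ∈ U₁, z + c₀ ∈ U₁ := fun z hz => by
      rw [hU₁eq] at hz ⊢; rw [← hU₁per]; exact mem_image_of_mem _ hz
    by_cases hdU : u₂ - u₁ = c₀
    · have hU₀per := per2 hdU
      have hU₀c : ∀ z ∈ U₀, z + c₀ ∈ U₀ := fun z hz => by
        rw [hU₀eq] at hz ⊢; rw [← hU₀per]; exact mem_image_of_mem _ hz
      exact no_36_shape_f_coset_abs hρρ hρτ hτρ hττ hρ hτ hne h hs₀ hs₁ ht₀ ht₁ hU₀c hU₁c ⟨u₁, hu₁m⟩ ⟨v₁, hv₁m⟩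
        π hπ hQ
    -- Case A2: the exact vertex `110` = vertex `000` of `(S·τ0, T·τ0, U)`
    have er : (Equiv.mulRight (1 : G)).toEmbedding = Function.Embedding.refl G := by ext x; simp
    have h'' := h.map_mulRight (τ 0) (τ 0) 1
    simp only [er, Finset.map_refl] at h''
    set S'' := S.map (Equiv.mulRight (τ 0)).toEmbedding with hS''def
    set T'' := T.map (Equiv.mulRight (τ 0)).toEmbedding with hT''def
    set S₀'' : Finset (A) := univ.filter fun a => ρ a ∈ S'' with hS₀''
    set S₁'' : Finset (A) := univ.filter fun a => τ a ∈ S'' with hS₁''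
    set T₀'' : Finset (A) := univ.filter fun a => ρ a ∈ T'' with hT₀''
    set T₁'' : Finset (A) := univ.filter fun a => τ a ∈ T'' with hT₁''
    have eS₀'' : S₀'' = ({-c₀ - s₁, -c₀ - s₂} : Finset _) := by
      rw [hS₀'', hS''def, rho_part_mulRight_tau hρρ hρτ hττ, ← hS₁, hS₁eq, image_insert, image_singleton]
    have eS₁'' : S₁'' = ({-a₀} : Finset _) := by
      rw [hS₁'', hS''def, tau_part_mulRight_tau hρρ hττ, ← hS₀, hS₀a, image_singleton]
    have eT₀'' : T₀'' = ({-c₀ - t₁, -c₀ - t₂} : Finset _) := by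
      rw [hT₀'', hT''def, rho_part_mulRight_tau hρρ hρτ hττ, ← hT₁, hT₁eq, image_insert, image_singleton]
    have eT₁'' : T₁'' = ({-t} : Finset _) := by
      rw [hT₁'', hT''def, tau_part_mulRight_tau hρρ hττ, ← hT₀, hT₀t, image_singleton]
    have mS₀'' : ∀ a ∈ S₀'', cond false (τ a) (ρ a) ∈ S'' := fun a ha => by simpa [hS₀''] using ha
    have mS₁'' : ∀ a ∈ S₁'', cond true (τ a) (ρ a) ∈ S'' := fun a ha => by simpa [hS₁''] using ha
    have mT₀'' : ∀ a ∈ T₀'', cond false (τ a) (ρ a) ∈ T'' := fun a ha => by simpa [hT₀''] using ha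
    have mT₁'' : ∀ a ∈ T₁'', cond true (τ a) (ρ a) ∈ T'' := fun a ha => by simpa [hT₁''] using ha
    have hst : -c₀ - s₁ ≠ -c₀ - s₂ := fun e => hs12 (sub_right_injective e)
    have htt : -c₀ - t₁ ≠ -c₀ - t₂ := fun e => ht12 (sub_right_injective e)
    have cS₀'' : S₀''.card = 2 := by rw [eS₀'', card_pair hst]
    have cS₁'' : S₁''.card = 1 := by rw [eS₁'', card_singleton]
    have cT₀'' : T₀''.card = 2 := by rw [eT₀'', card_pair htt]
    have cT₁'' : T₁''.card = 1 := by rw [eT₁'', card_singleton]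
    have cs'' := card_sumset' hρρ hττ hρ hτ h''
    set N₁ := (S₁'' ×ˢ T₀'' ×ˢ U₀).image fun p : (A) × (A) × (A) =>
      p.1 + p.2.1 + p.2.2 with hN₁
    set N₂ := (S₀'' ×ˢ T₁'' ×ˢ U₀).image fun p : (A) × (A) × (A) =>
      p.1 + p.2.1 + p.2.2 with hN₂
    set N₃ := (S₀'' ×ˢ T₀'' ×ˢ U₁).image fun p : (A) × (A) × (A) =>
      p.1 + p.2.1 + p.2.2 with hN₃
    have e₁ : Disjoint N₁ N₂ := (disjoint_sumset₁' hρρ hρτ hτρ hττ hne h'') false mS₁'' mT₀'' mU₀ mS₀'' mT₁''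
    have e₂ : Disjoint N₂ N₃ := (disjoint_sumset₂' hρρ hρτ hτρ hττ hne h'') false mS₀'' mT₁'' mU₀ mS₀'' mT₀'' mU₁
    have e₃ : Disjoint N₃ N₁ := (disjoint_sumset₃' hρρ hρτ hτρ hττ hne h'') false mS₀'' mT₀'' mU₁ mS₁'' mU₀
    have g₁ : Disjoint N₁ (N₂.image (· + c₀)) :=
      (disjoint_sumset₁_shift' hρρ hρτ hττ hne h'') false mS₁'' mT₀'' mU₀ mS₀'' mT₁''
    have g₂ : Disjoint (N₃.image (· + c₀)) N₂ :=
      (disjoint_sumset₂_shift' hρρ hρτ hττ hne h'') false mS₀'' mT₀'' mU₁ mS₀'' mT₁'' mU₀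
    have g₃ : Disjoint N₁ (N₃.image (· + c₀)) :=
      (disjoint_sumset₃_shift' hρρ hρτ hτρ hττ hne h'') false mS₁'' mT₀'' mU₀ mS₀'' mU₁
    have cN₁ : N₁.card = 4 := by rw [hN₁, cs'' true false false mS₁'' mT₀'' mU₀, cS₁'', cT₀'', hu₀]
    have cN₂ : N₂.card = 4 := by rw [hN₂, cs'' false true false mS₀'' mT₁'' mU₀, cS₀'', cT₁'', hu₀]
    have cN₃ : N₃.card = 8 := by rw [hN₃, cs'' false false true mS₀'' mT₀'' mU₁, cS₀'', cT₀'', hu₁]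
    have hperN₁ : N₁.image (· + c₀) = N₁ :=
      periodic_of_exact_vertex e₁ e₃.symm e₂ (by rw [cN₁, cN₂, cN₃, hA]) (disjoint_image_add_comm h2c g₁)
        (disjoint_image_add_comm h2c g₃)
    have hperN₂ : N₂.image (· + c₀) = N₂ :=
      periodic_of_exact_vertex e₁.symm e₂ e₃.symm (by rw [cN₁, cN₂, cN₃, hA]) g₁.symm
        (disjoint_image_add_comm h2c g₂.symm)
    have critTU : (-c₀ - t₂) - (-c₀ - t₁) = c₀ ∨ u₂ - u₁ = c₀ ∨
        (((-c₀ - t₂) - (-c₀ - t₁)) + ((-c₀ - t₂) - (-c₀ - t₁)) = 0 ∧ ((-c₀ - t₂) - (-c₀ - t₁)) + (u₂ - u₁) = c₀) := by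
      rw [hN₁, eS₁'', eT₀'', hU₀eq] at hperN₁
      exact two_set_criterion_fst hc₀ h2c htt hu12 hperN₁
    have critSU : (-c₀ - s₂) - (-c₀ - s₁) = c₀ ∨ u₂ - u₁ = c₀ ∨
        (((-c₀ - s₂) - (-c₀ - s₁)) + ((-c₀ - s₂) - (-c₀ - s₁)) = 0 ∧ ((-c₀ - s₂) - (-c₀ - s₁)) + (u₂ - u₁) = c₀) := by
      rw [hN₂, eS₀'', eT₁'', hU₀eq] at hperN₂
      exact two_set_criterion_mid hc₀ h2c hst hu12 hperN₂
    rcases critTU with k | k | ⟨-, kT⟩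
    · -- `T₁` periodic together with `U₁`: `S₀ + T₁ + U₁` is not injective
      have hdT : t₂ - t₁ = c₀ := by linear_combination (norm := abel1) -k - h2c
      exact not_injOn_of_periodic₂₃ hc₀ (by rw [hT₁eq]; exact per2 hdT) (by rw [hU₁eq]; exact per2 hdV)
        ⟨a₀, by rw [hS₀a]; exact mem_singleton_self _⟩ ⟨t₁, ht₁m⟩ ⟨v₁, hv₁m⟩ (inj false true true mS₀ mT₁ mU₁)
    · exact hdU k
    rcases critSU with k | k | ⟨-, kS⟩
    · have hdS : s₂ - s₁ = c₀ := by linear_combination (norm := abel1) -k - h2c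
      exact not_injOn_of_periodic₁₃ hc₀ (by rw [hS₁eq]; exact per2 hdS) (by rw [hU₁eq]; exact per2 hdV)
        ⟨s₁, hs₁m⟩ ⟨t, by rw [hT₀t]; exact mem_singleton_self _⟩ ⟨v₁, hv₁m⟩ (inj true false true mS₁ mT₀ mU₁)
    · exact hdU k
    · exact noST (by linear_combination (norm := abel1) kS - kT)
  · -- Case B: `d_V ≠ c₀`
    rcases critTV with kT | k | ⟨hTT, kT⟩
    · rcases critSV with kS | k | ⟨hSS, kS⟩
      · exact noST (by rw [kT, kS])
      · exact hdV k
      · exact no111 (by linear_combination (norm := abel1) kS - kT - hSS)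
    · exact hdV k
    · rcases critSV with kS | k | ⟨-, kS⟩
      · exact no111 (by linear_combination (norm := abel1) kT - kS - hTT)
      · exact hdV k
      · exact noST (by linear_combination (norm := abel1) kT - kS)

end ShapeF

end Summit.MatrixMultiplication.OmegaCensus
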